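import Summits.QuantumFields.BalabanUV.Beta.GAN24.FibreStripJMHolds
import Summits.QuantumFields.BalabanUV.Beta.GAN24.RealRateKMHolds
import Summits.QuantumFields.BalabanUV.Beta.FP.SymmetryK

/-!
# `BalabanUV.Beta.GAN24.KSlotJMHolds` — binder row G-an2-4 ∕ (CONV-C), lineage gan24-p3 (part P3, Woodbury ∕ fibre layer):
# **THE K-SLOT OF asym1's (CONV-C-Cauchy) BINDERS AT EVERY RELATIVE BLOCKING `m ≥ 1` — UNCONDITIONAL IN DIMENSION FOUR** (`d = 3`, every `Lc ≥ 2`, adopted units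
# `(sfStep Lc, smStep 3 Lc)`): the unit-rescaled (j, m)-resolvent family `U_j := unitK (sfStep Lc j) (smStep 3 Lc j) (FP.PerfectObjects.KTot (Lc^(j+m)) (Lc^j))` has a
# `j`-UNIFORM `Decays` bound (`hK`) AND a `Decays`-currency Cauchy rate `cK·θ^k` with `θ = Lc⁻¹ < 1` (`hKall`) — EXACTLY the two K-side hypothesis SHAPES of road FP's
# level-`m` sockets (`FP.TransportInfinityM.entryHyps_perfCol` ∕ `entryHyps_colOf`, `FP.SymmetryK.kernelSide_KPerf`, `FP.StepLawAssembly`) — and converges to the perfect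
# `m`-fold resolvent `KPerf … m` AT GEOMETRIC RATE IN THE WEIGHTED `Decays` CURRENCY (gen 13 had the sup-norm rate only)

NOT IN PRINT; OUR PROOF (assembly of tree theorems BY NAME: this lineage's `FibreStripJMHolds.stripRegularKM_holds` ((I3′) at relative blocking `Lc^m`, gen 14) and
`RealRateKMHolds.realRateKM_holds` ((I2′) at relative blocking `Lc^m`, gen 13) through `FibreStripJM.uniformDecays_of_stripRegularKM` ∕
`decayCauchy_of_stripRegularKM_realRateKM` = road P1's K-slot route `CombesThomas.decayCauchy_of_uniformDecays_supRate` one relative blocking up).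
HONEST FRAMING (cell contract, verbatim): «discharging `BetaPertH` makes Bałaban's UV stability UNCONDITIONAL — a real constructive-QFT result; it is NOT the continuum
limit and NOT the Clay problem.»  HONEST DEPENDENCY (verbatim): «continuum YM on T⁴ ⇐ BetaPertH ∧ nine spine estimates (0/9 proved); BetaPertH ⇐ (D1) ∧ (D4) ∧
CAP+tail; G-an2-4 gates asym, D1 and NE2/3/4.»  HEADLINE DISCIPLINE: «the (j, m)-resolvent family satisfies asym1's two K-binders (uniform decay + Cauchy decay) for
every m ≥ 1, and converges to `KPerf … m` at geometric rate in the `Decays` currency» — K-side only; X1m-S∕W (the stencil ∕ table families), N0b-K's alias closed form,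
N2∕N7, the step law and EVERYTHING of the wall (S-slot gate hold, W-pin) UNTOUCHED; 0 wall binders instantiated; NEVER «G-an2-4 closed», NOT BetaPertH, NOT continuum,
NOT Clay.  PRECEDENCE NOTE: the ADMISSIBILITY DOOR of road FP's N5b-2 at every `m` (`EntryHyps (Lc^m) (colOf (KPerf … m)) 𝒯`, `hasSum_transport_m2Tensor`,
`coarseTensor = m2Tensor`) was discharged FIRST by beta-d1-formalise-leaf-06's `FP/StepLawKHolds` (REBASE: `KPerf … m = KPerf (Lc^m) … 1` + the `m = 1` door at base `Lc^m`)
— those three statements are theirs and are NOT restated here; this module supplies the APPROXIMANT-LEVEL binders `hK`∕`hKall` themselves (which the rebase does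
not give: it concerns the limit column only) — the second inhabitant of the same door through `TransportInfinityM.entryHyps_perfCol` — and the weighted rate to the limit.

CONTENT (`d = 3`):
* §1 `decayCauchyKM_holds` (`2 ≤ Lc`, `1 ≤ m`): the Cauchy currency with explicit constants
  (`√(2·(c_m∕(1−Lc⁻²))·Cst·e^{2κ})`, `√(Lc⁻²)`, `κ∕((3+1)·Lc^m)∕2`, `c_m = (cFF+cMF+cMF+cmm)(Lc^m)`); **`kSlotJM_holds`**: the bundle
  `∃ C δ cK θ, 0 < δ ∧ 0 ≤ θ ∧ θ < 1 ∧ (∀ j, Decays (U_j) C δ) ∧ (∀ k j, Decays (U_{k+j} − U_k) (cK·θ^k) δ)` — the SHAPE of `GAN24.CombesThomas.ConvCKWall` for the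
  (j, m)-family (at `m = 1` it is `KSlotAssembly.convCKWall_holds`' content, by a parallel route).
* §2 **`decays_KTot_sub_KPerf_holds`** (`2 ≤ Lc`, `1 ≤ m`): `∃ cK δ θ, 0 < δ ∧ 0 ≤ θ ∧ θ < 1 ∧ ∀ k, Decays (U_k − KPerf Lc (sfStep Lc) (smStep 3 Lc) m) (cK·θ^k) δ` — THE
  (j, m)-FAMILY CONVERGES TO THE PERFECT `m`-FOLD RESOLVENT AT GEOMETRIC RATE IN THE WEIGHTED `Decays` CURRENCY (asym1's `HessKerDressedLimit.decays_sub_limMKerOf`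
  on `hKall`; `KPerf … m` IS the constructed limit of the family by `rfl`); `decays_KPerf_explicit` (the limit's decay with the SAME explicit constant and rate as `hK`).
* §3 `axisReflectionCovariant_flipK_hessKer_KPerf_holds` (`1 ≤ m`): the typed reflection law of the undressed perfect `m`-fold one-loop kernel for ANY covariant jet datum
  on blocking `Lc^m` — an5's `ResolventReflection.axisReflectionCovariant_flipK_hessKer` with its three kernel-side inputs supplied by gen 13's
  `RealRateKMHolds.kernelSide_KPerf_holds` (the four jet covariances stay HYPOTHESES; `m = 1` is `FP.SymmetryKHolds`).

ABSOLUTE RULE (cell, verbatim): «No internally-minted statement may enter as a cited fact. Every hypothesis is either kernel-proved in this package or a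
verbatim quotation of a PUBLISHED theorem with page reference.»  Nothing is cited; no `def`; every input is a tree theorem imported BY NAME.
-/

noncomputable section

open Filter Topology Finset
open scoped BigOperators Real
open Literature.MathematicalPhysics.QuantumFieldTheory.Balaban1983to89
open Literature.MathematicalPhysics.QuantumFieldTheory.Balaban1983to89.Beta
open ExpKernelCalculus (MKer Decays shiftK hessKer)
open PolarizationSign (reflSign AxisReflectionCovariant)
open KernelReflection (refK)
open ResolventReflection (Φ bref axisReflectionCovariant_flipK_hessKer)
open OneStepResolventKernel (Fib JetData)
open OneStepKernelFamily (flipK vertexOfK)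
open Summit.QuantumFields.BalabanUV.Beta.HessKerDressedUnits (unitK)
open Summit.QuantumFields.BalabanUV.Beta.GAN24.CombesThomas (sfStep smStep UniformDecays DecayCauchy decays_of_le_rate sqrt_rate_lt_one)
open Summit.QuantumFields.BalabanUV.Beta.GAN24.FibreRate (cFF cMF)
open Summit.QuantumFields.BalabanUV.Beta.GAN24.FibreRateOfLegs (cmm)
open Summit.QuantumFields.BalabanUV.Beta.GAN24.PerfectStepFibre (theta_nonneg_lt_one)
open Summit.QuantumFields.BalabanUV.Beta.GAN24.FibreStripJM (StripRegularKM uniformDecays_of_stripRegularKM decayCauchy_of_stripRegularKM_realRateKM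
  cst_nonneg_of_stripRegularKM)
open Summit.QuantumFields.BalabanUV.Beta.GAN24.FibreStripJMHolds (stripRegularKM_holds)
open Summit.QuantumFields.BalabanUV.Beta.GAN24.RealRateKMHolds (realRateKM_holds exists_tendsto_KTot_holds kernelSide_KPerf_holds)
open Summit.QuantumFields.BalabanUV.Beta.FP.PerfectObjects (KTot)
open Summit.QuantumFields.BalabanUV.Beta.FP.PerfectObjectsT (KPerf)
open Summit.QuantumFields.BalabanUV.Beta.FP.SymmetryK (decays_KPerf)
open HessKerDressedLimit (decays_sub_limMKerOf)

namespace Summit.QuantumFields.BalabanUV.Beta.GAN24.KSlotJMHolds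

variable {Lc : ℕ} [NeZero Lc]

/-! ## §1 The two K-binders of the (j, m)-family, every `m ≥ 1` -/

/-- **THE `Decays`-CURRENCY CAUCHY RATE OF THE UNIT-RESCALED (j, m)-RESOLVENTS — UNCONDITIONAL** [our proof] (`d = 3`, `2 ≤ Lc`, `1 ≤ m`), explicit constants:
`∃ κ > 0, ∃ Cst, DecayCauchy (j ↦ unitK (sfStep Lc j) (smStep 3 Lc j) (KTot (Lc^(j+m)) (Lc^j))) (√(2·(c_m∕(1−Lc⁻²))·(Cst·e^{2κ}))) (√(Lc⁻²)) (κ∕((3+1)·Lc^m)∕2)` with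
`c_m = cFF (Lc^m) + cMF (Lc^m) + cMF (Lc^m) + cmm (Lc^m)` — (I3′)_m (`stripRegularKM_holds`) + (I2′)_m (`realRateKM_holds`) through `decayCauchy_of_stripRegularKM_realRateKM`. -/
theorem decayCauchyKM_holds (hLc : 2 ≤ Lc) {m : ℕ} (hm : 1 ≤ m) : ∃ κ, 0 < κ ∧ ∃ Cst, 0 ≤ Cst ∧
    DecayCauchy (fun j => unitK (sfStep Lc j) (smStep 3 Lc j) (KTot (d := 3) (Lc ^ (j + m)) (Lc ^ j)))
      (Real.sqrt (2 * ((cFF (Lc ^ m) + cMF (Lc ^ m) + cMF (Lc ^ m) + cmm (Lc ^ m)) / (1 - ((Lc : ℝ) ^ 2)⁻¹)) * (Cst * Real.exp (2 * κ))))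
      (Real.sqrt (((Lc : ℝ) ^ 2)⁻¹)) (κ / ((3 + 1) * (Lc : ℝ) ^ m) / 2) := by
  obtain ⟨κ, hκ, Cst, hA⟩ := stripRegularKM_holds (Lc := Lc) m
  exact ⟨κ, hκ, Cst, cst_nonneg_of_stripRegularKM hκ.le hA,
    decayCauchy_of_stripRegularKM_realRateKM hκ.le hA (theta_nonneg_lt_one hLc).1 (theta_nonneg_lt_one hLc).2 (realRateKM_holds hLc hm)⟩

/-- **THE K-SLOT OF asym1's (CONV-C-Cauchy) BINDERS AT RELATIVE BLOCKING `Lc^m` — UNCONDITIONAL** [our proof] (`d = 3`, `2 ≤ Lc`, `1 ≤ m`): in the SHAPE of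
`GAN24.CombesThomas.ConvCKWall` for the (j, m)-family,
`∃ C δ cK θ, 0 < δ ∧ 0 ≤ θ ∧ θ < 1 ∧ (∀ j, Decays (U_j) C δ) ∧ (∀ k j, Decays (U_{k+j} − U_k) (cK·θ^k) δ)`, `U_j := unitK (sfStep Lc j) (smStep 3 Lc j) (KTot (Lc^(j+m)) (Lc^j))`
— LITERALLY the hypothesis pair `hK`, `hKall` of `FP.TransportInfinityM.entryHyps_perfCol` ∕ `FP.SymmetryK.kernelSide_KPerf` (one common decay rate). -/
theorem kSlotJM_holds (hLc : 2 ≤ Lc) {m : ℕ} (hm : 1 ≤ m) :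
    ∃ C δ cK θ : ℝ, 0 < δ ∧ 0 ≤ θ ∧ θ < 1 ∧
      (∀ j, Decays (unitK (sfStep Lc j) (smStep 3 Lc j) (KTot (d := 3) (Lc ^ (j + m)) (Lc ^ j))) C δ) ∧
      (∀ k j, Decays (unitK (sfStep Lc (k + j)) (smStep 3 Lc (k + j)) (KTot (d := 3) (Lc ^ (k + j + m)) (Lc ^ (k + j))) -
        unitK (sfStep Lc k) (smStep 3 Lc k) (KTot (d := 3) (Lc ^ (k + m)) (Lc ^ k))) (cK * θ ^ k) δ) := by
  obtain ⟨κ, hκ, Cst, hA⟩ := stripRegularKM_holds (Lc := Lc) m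
  have hθ := theta_nonneg_lt_one hLc
  have hK := uniformDecays_of_stripRegularKM hκ.le hA
  have hKall := decayCauchy_of_stripRegularKM_realRateKM hκ.le hA hθ.1 hθ.2 (realRateKM_holds hLc hm)
  have hCst : 0 ≤ Cst := cst_nonneg_of_stripRegularKM hκ.le hA
  have hLm : (0 : ℝ) < (Lc : ℝ) ^ m := pow_pos (by exact_mod_cast Nat.pos_of_ne_zero (NeZero.ne Lc)) m
  have hδ : 0 < κ / ((3 + 1) * (Lc : ℝ) ^ m) := div_pos hκ (by positivity)
  refine ⟨Cst * Real.exp (2 * κ), κ / ((3 + 1) * (Lc : ℝ) ^ m) / 2, _, Real.sqrt (((Lc : ℝ) ^ 2)⁻¹), by positivity, Real.sqrt_nonneg _,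
    sqrt_rate_lt_one hθ.2, fun j => ?_, fun k j => hKall k j⟩
  exact decays_of_le_rate (hK j) (by positivity) (by linarith)

/-! ## §2 The weighted rate to the perfect `m`-fold resolvent, and the limit's decay with explicit constants -/

/-- **THE (j, m)-FAMILY CONVERGES TO THE PERFECT `m`-FOLD RESOLVENT AT GEOMETRIC RATE IN THE WEIGHTED `Decays` CURRENCY — UNCONDITIONAL** [our proof]
(`d = 3`, `2 ≤ Lc`, `1 ≤ m`): `∃ cK δ θ, 0 < δ ∧ 0 ≤ θ ∧ θ < 1 ∧ ∀ k, Decays (U_k − KPerf Lc (sfStep Lc) (smStep 3 Lc) m) (cK·θ^k) δ` — asym1's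
`HessKerDressedLimit.decays_sub_limMKerOf` (no `1∕(1−θ)`) on §1's `hKall`; `KPerf … m` is the constructed limit `limMKerOf` of the family by `rfl`.  (Gen 13's
`RealRateKMHolds.abs_KTot_sub_KPerf_holds` is the sup-norm rate; this is the rate WITH the exponential weight `e^{−δ|x′−y′|₁}`.) -/
theorem decays_KTot_sub_KPerf_holds (hLc : 2 ≤ Lc) {m : ℕ} (hm : 1 ≤ m) :
    ∃ cK δ θ : ℝ, 0 < δ ∧ 0 ≤ θ ∧ θ < 1 ∧
      ∀ k, Decays (unitK (sfStep Lc k) (smStep 3 Lc k) (KTot (d := 3) (Lc ^ (k + m)) (Lc ^ k)) - KPerf (d := 3) Lc (sfStep Lc) (smStep 3 Lc) m)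
        (cK * θ ^ k) δ := by
  obtain ⟨C, δ, cK, θ, hδ, hθ0, hθ1, _hK, hKall⟩ := kSlotJM_holds hLc hm
  exact ⟨cK, δ, θ, hδ, hθ0, hθ1, fun k =>
    decays_sub_limMKerOf (K := fun j => unitK (sfStep Lc j) (smStep 3 Lc j) (KTot (d := 3) (Lc ^ (j + m)) (Lc ^ j))) hKall hθ1 k⟩

/-- [our proof] **THE PERFECT `m`-FOLD RESOLVENT DECAYS WITH THE SAME EXPLICIT CONSTANT AND RATE AS THE FAMILY** (`d = 3`, `2 ≤ Lc`, `1 ≤ m`): from (I3′)_m's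
`StripRegularKM 3 Lc m κ Cst`, `Decays (KPerf Lc (sfStep Lc) (smStep 3 Lc) m) (Cst·e^{2κ}) (κ∕((3+1)·Lc^m))` — `FP.SymmetryK.decays_KPerf` with `hK` ∕ `hconv` supplied
(gen 13's `kernelSide_KPerf_holds` gives the decay with the REBASED `m = 1` constants at base `Lc^m`; this is the direct route with (I3′)_m's constants). -/
theorem decays_KPerf_explicit (hLc : 2 ≤ Lc) {m : ℕ} (hm : 1 ≤ m) {κ Cst : ℝ} (hκ : 0 ≤ κ) (hA : StripRegularKM 3 Lc m κ Cst) :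
    Decays (KPerf (d := 3) Lc (sfStep Lc) (smStep 3 Lc) m) (Cst * Real.exp (2 * κ)) (κ / ((3 + 1) * (Lc : ℝ) ^ m)) :=
  decays_KPerf Lc (sfStep Lc) (smStep 3 Lc) m (uniformDecays_of_stripRegularKM hκ hA) (exists_tendsto_KTot_holds hLc hm)

/-! ## §3 The typed reflection law of the undressed perfect `m`-fold one-loop kernel, kernel side unconditional (every `m ≥ 1`) -/

/-- **THE TYPED REFLECTION LAW (5.7)–(5.8) OF THE UNDRESSED PERFECT `m`-FOLD ONE-LOOP KERNEL, KERNEL SIDE UNCONDITIONAL** [our proof] (`d = 3`, `2 ≤ Lc`, `1 ≤ m`):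
for ANY jet datum `J` on blocking `Lc^m` whose stencil family is block-translation (St♭) and reflection (Sr) covariant and whose second-order family is
block-translation (Wt) and reflection (Wr) covariant, `AxisReflectionCovariant (flipK (hessKer (KPerf … m) (vertexOfK (KPerf … m) (Lc^m) J.S) J.W))` — an5's
`ResolventReflection.axisReflectionCovariant_flipK_hessKer` with its three kernel-side inputs (`hKd`, `hKs`, `hKr`) supplied by gen 13's `RealRateKMHolds.kernelSide_KPerf_holds`.
The four jet covariances stay HYPOTHESES (N3(ii)-S∕W of road FP); `m = 1` is `FP.SymmetryKHolds.axisReflectionCovariant_flipK_hessKer_KPerf_one_holds`. -/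
theorem axisReflectionCovariant_flipK_hessKer_KPerf_holds (hLc : 2 ≤ Lc) {m : ℕ} (hm : 1 ≤ m) (J : JetData 3 (Lc ^ m))
    (hSt : ∀ (κ' : Fin (3 + 1)) (u t : Fin (3 + 1) → ℤ),
      J.S κ' (u + ((Lc ^ m : ℕ) : ℤ) • t) = shiftK (-(((Lc ^ m : ℕ) : ℤ) • t)) (J.S κ' u))
    (hWt : ∀ (μ : Fin (3 + 1)) (y : Fin (3 + 1) → ℤ) (ν : Fin (3 + 1)) (y' t : Fin (3 + 1) → ℤ),
      J.W μ (y + t) ν (y' + t) = shiftK (-(((Lc ^ m : ℕ) : ℤ) • t)) (J.W μ y ν y'))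
    (hSr : ∀ (α κ' : Fin (3 + 1)) (u : Fin (3 + 1) → ℤ),
      J.S κ' (bref α κ' u) = reflSign α κ' • refK (Φ (d := 3) (Lc ^ m) α) (J.S κ' u))
    (hWr : ∀ (α μ : Fin (3 + 1)) (y : Fin (3 + 1) → ℤ) (ν : Fin (3 + 1)) (y' : Fin (3 + 1) → ℤ),
      J.W μ (bref α μ y) ν (bref α ν y') = (reflSign α μ * reflSign α ν) • refK (Φ (d := 3) (Lc ^ m) α) (J.W μ y ν y')) :
    AxisReflectionCovariant (flipK (hessKer (KPerf (d := 3) Lc (sfStep Lc) (smStep 3 Lc) m)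
      (vertexOfK (KPerf (d := 3) Lc (sfStep Lc) (smStep 3 Lc) m) (Lc ^ m) J.S) J.W)) := by
  obtain ⟨hKd, hKs, hKr⟩ := kernelSide_KPerf_holds hLc hm
  exact axisReflectionCovariant_flipK_hessKer hKd hKs hKr J hSt hWt hSr hWr

end Summit.QuantumFields.BalabanUV.Beta.GAN24.KSlotJMHolds

end
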